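/-
Copyright (c) 2026 the pub-hodgecm-mathlib formalisation cell (harness21).  Prover seat hodgecm-mathlib-K2Liu-p14 (g5) (cross-line VALVE 16 (n) hand at section S6,
dealer R90-C14-plan (g2), card GF1 «G-SIDE FIX DATA», FILE 1, 2026-09-05T02:23Z «GO»; DEDUP RULING A: the generic bookkeeping lemma for BOTH trees).  THEOREMS ONLY
(no `def`, no `instance`, no notation, no named-fact hypothesis, no `sorry`); lane `--supports stmt-HodgeConjecture-24833 --as helper` (count-neutral helper).
-/
import Summits.HodgeConjecture.HodgeConjecture.Theorems.R90S6TreeDisplacementSphereCount   -- ★ W8-f `ncard_displaced_two_inter_type_eq_sum` (+ ★ tree organs)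
import Literature.Combinatorics.SimpleGraph.TreeAutomorphismFixedPoints                  -- ★ `BakerNorine.isTree_induce_fixed` (a non-empty fixed set induces a subtree)
import Mathlib.Combinatorics.SimpleGraph.Bipartite
import HarnessLib

/-!
# R90 · S6 — card GF1 FILE 1 `R90S6TreeFixDataFirstShell`: THE FIRST DISPLACEMENT SHELL FROM THE FIXED-VERTEX COUNTS ALONE
# `#{x : d(x, αx) = 2, type i} + #Fix α = d_j · #{y ∈ Fix α : type j} + 1`

Cell `hodgecm-mathlib`, crux H413 (`stmt-HodgeConjecture-24833`), route `HCCMUnconditional`; programme R90-TF, section S6 (base `R90-C14`, dealer R90-C14-plan (g2)),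
seat K2Liu-p14 (g5) (chair K2-lead VALVE 16 (n)); card **GF1** «G-side fix data of the four Flicker literals» (row E1.3.5.2.6, sheet v1.1 b34a1458), FILE 1 = the
literal-free, regime-free bookkeeping (census 2026-09-05T02:22Z, dealer «=» 02:23Z).  Generic graph theory, ★ W8-f's currency.

THE MATHEMATICS (Serre, *Trees* I.2.3, I.6.1, I.6.4; Kottwitz 1988 §2).  `G` a locally finite tree, `α : G ≃g G` with FINITE NON-EMPTY fixed set `F`, `c : V → Fin 2` a type
function (adjacent vertices have different types), and — the one new letter — the valency of the FIXED vertices depends on the type only: `deg y = d (c y)` for `y ∈ F`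
(on the Bruhat–Tits tree of `U(3)_w`: `q³ + 1` at hyperspecial, `q + 1` at special vertices; on the `(q+1)`-regular tree of `U(1,1)_w`: `d ≡ q + 1`).  By ★ W8-f
`ncard_displaced_two_inter_type_eq_sum`, the first displacement shell of type `i` counts the MOVED neighbours of the fixed vertices of the other type `j`:
`N′_i = Σ_{y ∈ F_j} (deg y − #{fixed neighbours of y})`.  The tree is bipartite for `c`, so every edge of the fixed subgraph `G[F]` has exactly one endpoint of type `j`:
`Σ_{y ∈ F_j} #{fixed neighbours of y} = #E(G[F])` (Mathlib `isBipartiteWith_sum_degrees_eq_card_edges` on `G[F]`); and `G[F]` is a finite TREE (★ `BakerNorine.isTree_induce_fixed`),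
so `#E(G[F]) + 1 = #F` (Mathlib `isTree_iff_connected_and_card`).  Hence **`N′_i + #F = d_j · #F_j + 1`** — the first displaced shells, and with ★ W8-f §2 ALL displacement
shells, are determined by the two fixed-vertex counts `#F_0, #F_1` alone (no fixed-edge count, no per-vertex residual data).  For the four Flicker literals this turns the ★ G1
rungs' `#Fix`-counts (special ∕ hyperspecial) into the sheet's `N′₀ᵢ, N′₁ᵢ` (GF1 FILE 2); for `U(1,1)` it is HF2 (iv) (R90-C14-p07) by name.
* `degree_induce_fixed_eq` — the degree in `G[F]` of a fixed vertex is the number of its fixed neighbours in `G`;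
* `sum_card_fixed_neighbors_add_one_eq_card_fixed` — `Σ_{y ∈ F_j} #{w ∈ N(y) : αw = w} + 1 = #F`;
* **`ncard_displaced_two_inter_type_add_card_fixed_eq`** — the head.
HONEST LABEL: generic graph theory; proves no printed global statement, discharges no citation; count-neutral helper until E1.3.5.2 ∕ E1.3.9 consume it.  HC_CM is proved only
modulo the 7 printed citations (2 remaining named inputs: hLiu418 = stmt-HodgeConjecture-24832, h413 = stmt-HodgeConjecture-24833) until rung 0 closes.

## References
* [Serre1980Trees] J.-P. Serre, *Trees* (1980), Ch. I §2.3 (trees), §6.1 (fixed points form a subtree), §6.4 Prop. 24 (`d(x, γx) = 2 d(x, Fix γ)`).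
* [Kottwitz1988] R. E. Kottwitz, *Tamagawa numbers*, Ann. of Math. 127 (1988), §2 (fixed subtree of an elliptic element; Euler characteristic `V − E = 1`).
* [Diestel2010] R. Diestel, *Graph Theory*, 4th ed. (2010), Prop. 1.6.1, Cor. 1.5.3 (a tree on `n` vertices has `n − 1` edges; bipartite handshake).
-/

set_option autoImplicit false
-- the mandated namespace repeats the single-problem summit's segment (`HodgeConjecture.HodgeConjecture`)
set_option linter.dupNamespace false

open SimpleGraph Finset
open Literature.Combinatorics.SimpleGraph

namespace Summit.HodgeConjecture.HodgeConjecture.R90.S6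

variable {V : Type*} {G : SimpleGraph V}

/-! ## §1 The fixed subtree: degrees and the edge count -/

/-- **The degree of a fixed vertex in the fixed subgraph `G[F]` is the number of its fixed neighbours in `G`.** [cite: Serre1980Trees, I.6.1] -/
theorem degree_induce_fixed_eq [DecidableEq V] [G.LocallyFinite] (α : G ≃g G) [Fintype {v | α v = v}]
    [DecidableRel (G.induce {v | α v = v}).Adj] (y : {v | α v = v}) :
    (G.induce {v | α v = v}).degree y = ((G.neighborFinset (y : V)).filter (fun w => α w = w)).card := by
  classical
  rw [← card_neighborFinset_eq_degree]
  refine Finset.card_bij (fun w _ => (w : V)) (fun w hw => ?_) (fun w₁ _ w₂ _ h => Subtype.ext h) (fun w hw => ?_)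
  · rw [mem_neighborFinset] at hw
    rw [mem_filter, mem_neighborFinset]
    exact ⟨hw, w.2⟩
  · rw [mem_filter, mem_neighborFinset] at hw
    exact ⟨⟨w, hw.2⟩, by rw [mem_neighborFinset]; exact hw.1, rfl⟩

/-- two-valuedness of the type: `a ≠ b`, `a ≠ j` forces `b = j` in `Fin 2`. [folklore] -/
theorem fin_two_eq_of_ne_of_ne {a b j : Fin 2} (hab : a ≠ b) (haj : a ≠ j) : b = j := by
  revert a b j; decide

/-- **THE FIXED SUBTREE HAS ONE MORE VERTEX THAN EDGES, READ BY TYPE**: `Σ_{y ∈ F, c y = j} #{w ∈ N(y) : αw = w} + 1 = #F` for a tree automorphism `α` with finite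
non-empty fixed set `F` and a type function `c` (adjacent vertices of different types).  The sum counts every edge of `G[F]` once, at its type-`j` endpoint (bipartite
handshake, Mathlib `isBipartiteWith_sum_degrees_eq_card_edges`), and `G[F]` is a finite tree (★ `BakerNorine.isTree_induce_fixed`, Mathlib `isTree_iff_connected_and_card`).
[cite: Kottwitz1988, §2] [cite: Serre1980Trees, I.6.1] [cite: Diestel2010, Cor. 1.5.3] -/
theorem sum_card_fixed_neighbors_add_one_eq_card_fixed [DecidableEq V] [G.LocallyFinite] (hT : G.IsTree) (α : G ≃g G) {u : V} (hu : α u = u)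
    (hfin : {v | α v = v}.Finite) (c : V → Fin 2) (hc : ∀ v w, G.Adj v w → c v ≠ c w) (j : Fin 2) :
    ∑ y ∈ hfin.toFinset.filter (fun y => c y = j), ((G.neighborFinset y).filter (fun w => α w = w)).card + 1 = hfin.toFinset.card := by
  classical
  haveI : Fintype {v | α v = v} := hfin.fintype
  -- the fixed subtree
  have hT' : (G.induce {v | α v = v}).IsTree := BakerNorine.isTree_induce_fixed hT α hu
  have hcardT : Nat.card (G.induce {v | α v = v}).edgeSet + 1 = Nat.card {v | α v = v} := ((isTree_iff_connected_and_card).1 hT').2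
  -- bipartite by type
  have hbip : (G.induce {v | α v = v}).IsBipartiteWith
      (((Finset.univ : Finset {v | α v = v}).filter (fun y : {v | α v = v} => c (y : V) = j) : Finset {v | α v = v}) : Set {v | α v = v})
      (((Finset.univ : Finset {v | α v = v}).filter (fun y : {v | α v = v} => c (y : V) ≠ j) : Finset {v | α v = v}) : Set {v | α v = v}) := by
    refine ⟨?_, fun y w hyw => ?_⟩
    · rw [Finset.disjoint_coe, Finset.disjoint_filter]
      exact fun y _ h => fun h' => h' h
    · have hyw' : G.Adj (y : V) (w : V) := hyw
      have hne := hc _ _ hyw'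
      simp only [coe_filter, mem_univ, true_and, Set.mem_setOf_eq]
      by_cases hy : c (y : V) = j
      · exact Or.inl ⟨hy, fun hw => hne (hy.trans hw.symm)⟩
      · exact Or.inr ⟨hy, fin_two_eq_of_ne_of_ne hne hy⟩
  have hsum := isBipartiteWith_sum_degrees_eq_card_edges hbip
  -- the three counts in one currency
  have hdeg : ∑ y ∈ (Finset.univ : Finset {v | α v = v}).filter (fun y : {v | α v = v} => c (y : V) = j), (G.induce {v | α v = v}).degree y =
      ∑ y ∈ hfin.toFinset.filter (fun y => c y = j), ((G.neighborFinset y).filter (fun w => α w = w)).card := by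
    rw [Finset.sum_filter, Finset.sum_filter]
    rw [Finset.sum_subtype hfin.toFinset (p := fun v => v ∈ {v | α v = v}) (fun x => by rw [Set.Finite.mem_toFinset])
      (fun y => if c y = j then ((G.neighborFinset y).filter (fun w => α w = w)).card else 0)]
    refine Finset.sum_congr rfl fun y _ => ?_
    split_ifs with h
    · exact degree_induce_fixed_eq α y
    · rfl
  have hE : ((G.induce {v | α v = v}).edgeFinset).card = Nat.card (G.induce {v | α v = v}).edgeSet := by
    rw [edgeFinset_card, Nat.card_eq_fintype_card]
  have hF : Nat.card {v | α v = v} = hfin.toFinset.card := by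
    rw [Nat.card_eq_fintype_card, Set.Finite.card_toFinset]
  rw [← hdeg, hsum, hE, ← hF]
  exact hcardT

/-! ## §2 The head: the first displacement shell from the fixed-vertex counts -/

/-- **THE FIRST DISPLACEMENT SHELL FROM THE FIXED-VERTEX COUNTS ALONE.**  `G` a locally finite tree, `α : G ≃g G` with finite non-empty fixed set `F = Fix α`, `c : V → Fin 2` a
type function (adjacent vertices have different types), `i ≠ j`, and `d : Fin 2 → ℕ` the valency BY TYPE at the FIXED vertices (`deg y = d (c y)` for `y ∈ F`).  Then
`#{x : d(x, αx) = 2 ∧ c x = i} + #F = d j · #{y ∈ F : c y = j} + 1`: ★ W8-f `ncard_displaced_two_inter_type_eq_sum` (the shell = moved neighbours of `F_j`), `deg y =` moved `+`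
fixed neighbours, and `sum_card_fixed_neighbors_add_one_eq_card_fixed`.  On `X₃` (`d = (q³+1, q+1)` by vertex type): `N′_sp = (q³+1)·V_hyp − (V_hyp + V_sp − 1)`,
`N′_hyp = (q+1)·V_sp − (V_hyp + V_sp − 1)`; with ★ W8-f §2 every displacement shell follows from `(V_hyp, V_sp)`.
[cite: Serre1980Trees, I.2.3, I.6.1, I.6.4 Prop. 24] [cite: Kottwitz1988, §2] [cite: Diestel2010, Prop. 1.6.1] -/
theorem ncard_displaced_two_inter_type_add_card_fixed_eq [DecidableEq V] [G.LocallyFinite] (hT : G.IsTree) (α : G ≃g G) {u : V} (hu : α u = u)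
    (hfin : {v | α v = v}.Finite) (c : V → Fin 2) (hc : ∀ v w, G.Adj v w → c v ≠ c w) {i j : Fin 2} (hij : i ≠ j)
    (d : Fin 2 → ℕ) (hdeg : ∀ y, α y = y → G.degree y = d (c y)) :
    {x | G.dist x (α x) = 2 ∧ c x = i}.ncard + hfin.toFinset.card = d j * (hfin.toFinset.filter (fun y => c y = j)).card + 1 := by
  classical
  rw [ncard_displaced_two_inter_type_eq_sum hT α hu hfin c hc hij, ← sum_card_fixed_neighbors_add_one_eq_card_fixed hT α hu hfin c hc j, ← add_assoc,
    ← Finset.sum_add_distrib]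
  -- at each fixed vertex of type `j`: moved + fixed neighbours = degree = `d j`
  have hy : ∀ y ∈ hfin.toFinset.filter (fun y => c y = j),
      ((G.neighborFinset y).filter (fun w => α w ≠ w)).card + ((G.neighborFinset y).filter (fun w => α w = w)).card = d j := by
    intro y hy
    rw [mem_filter, Set.Finite.mem_toFinset] at hy
    have h := Finset.card_filter_add_card_filter_not (s := G.neighborFinset y) (fun w => α w ≠ w)
    have h2 : ((G.neighborFinset y).filter (fun w => ¬ (α w ≠ w))) = (G.neighborFinset y).filter (fun w => α w = w) :=
      Finset.filter_congr fun w _ => not_not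
    rw [h2, card_neighborFinset_eq_degree, hdeg y hy.1, hy.2] at h
    exact h
  rw [Finset.sum_congr rfl hy, Finset.sum_const, smul_eq_mul, mul_comm]

end Summit.HodgeConjecture.HodgeConjecture.R90.S6
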